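import Summits.AtomisticToContinuum.Crystallization.Theorems.FreeSplittingCertificatesRadiusLadderJoint10over9
import Summits.AtomisticToContinuum.Crystallization.Theorems.FreeSplittingCertificatesRadiusLadderHardCoreFree
import Summits.AtomisticToContinuum.Crystallization.Theorems.FreeSplittingCertificatesRadiusLadderRadiusFloorApprox

/-!
# `FiniteRangeSplitting` (stmt-AtomisticToContinuum-12559): the atlas at the tree's best constant `δ_½ ≤ 10/9`

Support file for crux r2 of route `FreeSplittingCertificates` (block-2b unit `b2b-freesplit-A`, gen 55).
VALUE = theorems bracketing the crux — NOT summit progress.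

`…RadiusLadderCritical65` (gen 14) recorded the numeric atlas of the crux with the then-best certificate
`δ_½ ≤ 6/5` (the degree-`7` Delsarte layer cake).  The joint multi-shell SDP certificate of
`…RadiusLadderJoint10over9` (gen 41, `Joint10over9.halfSumThreshold_le_J`) improved the upper end of the bracket of
the half-rule threshold `δ_½ = halfSumThreshold` to `10/9`; this file propagates that constant through the derived
thresholds of the radius ladder, so that every atlas row cites a theorem:

* `critSep_le_ten_ninths`, `critSep_eq_zero_or_mem_Icc_ten_ninths` : the critical hard core `δ_c` is `0` (⟺ crux r2)
  or lies in `[2/5, 10/9]`;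
* `sepThreshold_mem_Icc_ten_ninths` : the separation threshold `δ*(R) ∈ [0, 10/9]` at every reading radius `R`;
* `radThreshold_eq_zero_of_ten_ninths_le` : the radius threshold `R*(δ) = 0` for every hard core `δ ≥ 10/9`;
* `critSepA_le_ten_ninths`, `critSepApprox_mem_Icc_ten_ninths`, `approxHalfSumThreshold_le_ten_ninths` : the
  tolerance-side thresholds (crux r5) inherit the same ceiling;
* `halfSumFeasible_decided109` : the deepest-site inequality is TRUE on `[10/9, ∞)`, FALSE on `(-∞, 47/50]`, and on
  the gap `(47/50, 10/9)` it is the closed condition `δ_½ ≤ δ` for ONE real number `δ_½ ∈ [47/50, 10/9]`;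
* `finiteRangeSplitting_iff_window109` : crux r2 ⟺ for every hard core `δ ∈ (0, 10/9)` there is a rung of reading
  radius `R ≥ 47/50`, and any rung at a hard core `δ < δ_½` has `R ≥ δ_½` (the radius floor of `…RadiusFloor`).
-/

noncomputable section

namespace Summit.AtomisticToContinuum.Crystallization.Theorems.StrictSplittingRuleBirth

open scoped BigOperators Classical
open Literature.MathematicalPhysics.StatisticalMechanics

/-! ## 1. The critical hard core -/

/-- `δ_c ≤ 10/9`. -/
theorem critSep_le_ten_ninths : critSep ≤ 10 / 9 :=
  critSep_le_halfSumThreshold.trans Joint10over9.halfSumThreshold_le_J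

/-- `δ_c ∈ [0, 10/9]`. -/
theorem critSep_mem_Icc_ten_ninths : critSep ∈ Set.Icc (0 : ℝ) (10 / 9) :=
  ⟨critSep_nonneg, critSep_le_ten_ninths⟩

/-- **The certified position of the critical hard core**: `δ_c = 0` (equivalently crux r2,
`finiteRangeSplitting_iff_critSep_eq_zero`) or `δ_c ∈ [2/5, 10/9]`. -/
theorem critSep_eq_zero_or_mem_Icc_ten_ninths : critSep = 0 ∨ critSep ∈ Set.Icc ((2 : ℝ) / 5) (10 / 9) :=
  critSep_eq_zero_or_two_fifths_le.imp_right fun h => ⟨h, critSep_le_ten_ninths⟩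

/-- `10/9 ∈ RungSet` (indeed every `δ ≥ 10/9`). -/
theorem mem_rungSet_of_ten_ninths_le {δ : ℝ} (h : 10 / 9 ≤ δ) : δ ∈ RungSet :=
  mem_rungSet_of_threshold_le (Joint10over9.halfSumThreshold_le_J.trans h)

/-! ## 2. The separation and radius thresholds -/

/-- `δ*(R) ≤ 10/9` at every reading radius. -/
theorem sepThreshold_le_ten_ninths (R : ℝ) : sepThreshold R ≤ 10 / 9 :=
  (sepThreshold_le_halfSumThreshold R).trans Joint10over9.halfSumThreshold_le_J

/-- `δ*(R) ∈ [0, 10/9]` at every reading radius. -/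
theorem sepThreshold_mem_Icc_ten_ninths (R : ℝ) : sepThreshold R ∈ Set.Icc (0 : ℝ) (10 / 9) :=
  ⟨sepThreshold_nonneg R, sepThreshold_le_ten_ninths R⟩

/-- `R*(δ) = 0` for every hard core `δ ≥ 10/9`: above `10/9` the half rule read at ANY radius is a rung. -/
theorem radThreshold_eq_zero_of_ten_ninths_le {δ : ℝ} (h : 10 / 9 ≤ δ) : radThreshold δ = 0 :=
  radThreshold_eq_zero_of_threshold_le (Joint10over9.halfSumThreshold_le_J.trans h)

/-! ## 3. The tolerance-side thresholds (crux r5) -/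

/-- `δ_A ≤ 10/9`. -/
theorem critSepA_le_ten_ninths : critSepA ≤ 10 / 9 :=
  critSepA_le_critSep.trans critSep_le_ten_ninths

/-- `δ_c(ε) ∈ [0, 10/9]` for every tolerance `ε ≥ 0`. -/
theorem critSepApprox_mem_Icc_ten_ninths {ε : ℝ} (hε : 0 ≤ ε) : critSepApprox ε ∈ Set.Icc (0 : ℝ) (10 / 9) :=
  ⟨critSepApprox_nonneg hε, (critSepApprox_le_critSep hε).trans critSep_le_ten_ninths⟩

/-- `δ_½(ε) ≤ 10/9` for every tolerance `ε ≥ 0`. -/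
theorem approxHalfSumThreshold_le_ten_ninths {ε : ℝ} (hε : 0 ≤ ε) : approxHalfSumThreshold ε ≤ 10 / 9 :=
  (approxHalfSumThreshold_le_halfSumThreshold hε).trans Joint10over9.halfSumThreshold_le_J

/-! ## 4. The deepest-site inequality and the window form of crux r2 -/

/-- **The deepest-site inequality, decided outside `(47/50, 10/9)` and closed inside**: TRUE for `δ ≥ 10/9`, FALSE
for `δ ≤ 47/50`, and equal to `δ_½ ≤ δ` with `δ_½ ∈ [47/50, 10/9]` everywhere. -/
theorem halfSumFeasible_decided109 (δ : ℝ) :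
    (10 / 9 ≤ δ → HalfSumFeasible δ) ∧ (δ ≤ 47 / 50 → ¬ HalfSumFeasible δ) ∧
      (HalfSumFeasible δ ↔ halfSumThreshold ≤ δ) ∧ halfSumThreshold ∈ Set.Icc ((47 : ℝ) / 50) (10 / 9) :=
  ⟨fun h => halfSumFeasible_mono h Joint10over9.halfSumFeasible_J, not_halfSumFeasible_of_le_47_50,
    halfSumFeasible_iff_threshold_le, Joint10over9.halfSumThreshold_mem_Icc_J⟩

/-- **The rungs, decided outside the gap**: every radius is a rung at a hard core `δ ≥ 10/9`; no radius `R < 47/50`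
is a rung at a hard core `δ ≤ 47/50`. -/
theorem rungAt_decided109 (δ R : ℝ) :
    (10 / 9 ≤ δ → RungAt δ R) ∧ (δ ≤ 47 / 50 → R < 47 / 50 → ¬ RungAt δ R) :=
  ⟨fun h => Joint10over9.rungAt_of_le h R, fun h47 hR => not_rungAt_47_50 δ R h47 hR⟩

/-- **The window form of crux r2 with the tree certificates**: it suffices (and is necessary) to find, for every
hard core `δ ∈ (0, 10/9)`, a rung of reading radius `R ≥ 47/50`; moreover every rung at a hard core below the
half-rule threshold `δ_½` reads at radius `R ≥ δ_½` (`threshold_le_radius_of_rungAt`). -/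
theorem finiteRangeSplitting_iff_window109 :
    Summit.AtomisticToContinuum.Crystallization.Theses.FreeSplittingCertificates.FiniteRangeSplitting ↔
      ∀ δ : ℝ, 0 < δ → δ < 10 / 9 →
        ∃ R : ℝ, 47 / 50 ≤ R ∧ (δ < halfSumThreshold → halfSumThreshold ≤ R) ∧ RungAt δ R := by
  rw [finiteRangeSplitting_iff_below (mem_rungSet_of_ten_ninths_le le_rfl)]
  refine forall₂_congr fun δ hδ => forall_congr' fun _ => ⟨?_, ?_⟩
  · rintro ⟨R, -, hr⟩
    have hr' : RungAt δ (max R (47 / 50)) := rungAt_mono_radius (le_max_left R _) hr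
    exact ⟨max R (47 / 50), le_max_right R _, fun hlt => threshold_le_radius_of_rungAt hδ hlt hr', hr'⟩
  · rintro ⟨R, hR, -, hr⟩
    exact ⟨R, lt_of_lt_of_le (by norm_num) hR, hr⟩

/-- **Atlas summary** (one conjunction, for citation): the four thresholds of the radius ladder against the tree
certificates `47/50 ≤ δ_½ ≤ 10/9`. -/
theorem atlas109 :
    halfSumThreshold ∈ Set.Icc ((47 : ℝ) / 50) (10 / 9) ∧
    (critSep = 0 ∨ critSep ∈ Set.Icc ((2 : ℝ) / 5) (10 / 9)) ∧
    (∀ R : ℝ, sepThreshold R ∈ Set.Icc (0 : ℝ) (10 / 9)) ∧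
    (∀ δ : ℝ, 10 / 9 ≤ δ → radThreshold δ = 0) ∧
    (Summit.AtomisticToContinuum.Crystallization.Theses.FreeSplittingCertificates.FiniteRangeSplitting ↔
      critSep = 0) :=
  ⟨Joint10over9.halfSumThreshold_mem_Icc_J, critSep_eq_zero_or_mem_Icc_ten_ninths, sepThreshold_mem_Icc_ten_ninths,
    fun _ h => radThreshold_eq_zero_of_ten_ninths_le h, finiteRangeSplitting_iff_critSep_eq_zero⟩

end Summit.AtomisticToContinuum.Crystallization.Theorems.StrictSplittingRuleBirth

end
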